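import Summits.CriticalPhenomena.PercolationContinuityZ3.Theorems.PercNearOneGluingNoHeavyLowerTailSBTens
import HarnessLib

/-!
# Scaled-Bernstein tensors II: Kronecker packing into big integers (fast certificate evaluation)
# (`NoHeavyLowerTail` cell, stmt-CriticalPhenomena-4575; prover `prim-hp-2`, gen 17)

Support file (`--supports stmt-CriticalPhenomena-4575`).  Computable definitions + soundness; no named facts, no sorries.

`…SBTens` checks `allNonneg` of a tensor built by nested-list convolutions; in the interpreter this costs ≈ 1.5 µs per leaf product,
fine for the 12-variable BILINEAR conditions of THEOREM B (≈ 10⁷ products) but not for the TRILINEAR ones (≈ 2·10⁹).  This file moves the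
arithmetic into big-integer multiplication (GMP, native even from the interpreter):
* `ienc B n T : ℤ` — Kronecker substitution: the tensor read as an integer in base `2^B` along the radix-4 flattening of its multi-index
  (`x_k ↦ 2^(B·4^k)`); `ienc_add/sub/mul/lift`: on well-formed tensors it is a ring homomorphism (proved from the generic list lemmas of
  `…SBTens` instantiated at the real point `(2^(B·4^k), 1)`), so the encoding of a ±-combination of products is computed from the encodings
  of the (small) factors by a handful of integer multiplications;
* `bnd R n T` — all leaves have absolute value `≤ R`; `bnd_add/smul/mul/…`: a-priori bounds on the leaves of the (never materialised) result;
The digit ranges and the recursive digit test with its soundness (`U`, `off`, `dec`, `dec_sound`) are in the continuation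
`…SBTensKronDigits`.  Customer: `…KNGoodGMgcCertFast` (the eighteen trilinear conditions of THEOREM B, ≈ 10 s each).
[folklore: Kronecker substitution; positional number systems]
-/

namespace Summit.CriticalPhenomena.PercolationContinuityZ3.Theorems

namespace SBTens

/-! ## Encoding -/

/-- Bit offset of variable `k`: `B · 4^k`. [folklore] -/
def gexp (B k : ℕ) : ℕ := B * 4 ^ k

/-- Left shift on `ℤ` through the natural-number shift (fast). [folklore] -/
def ishl (m : ℤ) (g : ℕ) : ℤ :=
  match m with
  | Int.ofNat a => Int.ofNat (a <<< g)
  | Int.negSucc a => -(Int.ofNat ((a + 1) <<< g))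

/-- `ishl m g = m · 2^g`. [folklore] -/
theorem ishl_eq (m : ℤ) (g : ℕ) : ishl m g = m * 2 ^ g := by
  cases m with
  | ofNat a => simp [ishl, Nat.shiftLeft_eq]
  | negSucc a =>
    simp only [ishl, Nat.shiftLeft_eq, Int.ofNat_eq_natCast, Int.negSucc_eq]
    push_cast; ring

/-- Horner encoding of a coefficient list at the point `2^g`: `Σ_i enc(L_i) · 2^(g·i)`. [folklore] -/
def iencL {α : Type} (enc : α → ℤ) (g : ℕ) : List α → ℤ
  | [] => 0
  | c :: C => enc c + ishl (iencL enc g C) g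

/-- Kronecker encoding of a tensor: variable `k` is sent to `2^(B·4^k)`. [folklore] -/
def ienc (B : ℕ) : (n : ℕ) → Tens n → ℤ
  | 0, a => toInt a
  | k + 1, L => iencL (ienc B k) (gexp B k) (toList L)

/-- The Horner encoding is the homogeneous list evaluation at `(2^g, 1)`, cast to `ℝ`. [folklore] -/
theorem iencL_cast {α : Type} (enc : α → ℤ) (g : ℕ) :
    ∀ L : List α, (iencL enc g L : ℝ) = evalL (fun c => (enc c : ℝ)) ((2 : ℝ) ^ g) 1 L
  | [] => by simp [iencL]
  | c :: C => by
    rw [iencL, ishl_eq, evalL_cons, ← iencL_cast enc g C]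
    push_cast; ring

/-- `ienc` at depth `k+1` as a real list evaluation. [folklore] -/
theorem ienc_succ_cast (B k : ℕ) (L : Tens (k + 1)) :
    (ienc B (k + 1) L : ℝ) = evalL (fun c => (ienc B k c : ℝ)) ((2 : ℝ) ^ gexp B k) 1 (toList L) :=
  iencL_cast _ _ _

/-- `ienc` is additive on well-formed tensors of equal shape. [folklore] -/
theorem ienc_add (B : ℕ) : ∀ (n : ℕ) (ds : List ℕ) (A A' : Tens n), WF n ds A → WF n ds A' →
    ienc B n (add n A A') = ienc B n A + ienc B n A'
  | 0, _, a, a', _, _ => by simp [ienc, add]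
  | n + 1, [], A, _, hA, _ => absurd hA (WF_succ_nil n A)
  | n + 1, d :: ds, A, A', hA, hA' => by
    rw [WF_succ] at hA hA'
    have key := evalL_zipLong ((2 : ℝ) ^ gexp B n) 1 (WF n ds) (fun c => (ienc B n c : ℝ)) (add n)
      (fun c c' hc hc' => ⟨(add_spec n ds c c' hc hc').1, by exact_mod_cast ienc_add B n ds c c' hc hc'⟩)
      (toList A) (toList A') (by rw [hA.1, hA'.1]) hA.2 hA'.2
    have h : (ienc B (n + 1) (add (n + 1) A A') : ℝ) = ienc B (n + 1) A + ienc B (n + 1) A' := by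
      rw [ienc_succ_cast, ienc_succ_cast, ienc_succ_cast]
      show evalL _ _ _ (zipLong (add n) (toList A) (toList A')) = _
      rw [key.2.2, one_pow, one_mul]
    exact_mod_cast h

/-- `ienc` commutes with integer multiples. [folklore] -/
theorem ienc_smul (B : ℕ) : ∀ (n : ℕ) (ds : List ℕ) (z : ℤ) (A : Tens n), WF n ds A →
    ienc B n (smul n z A) = z * ienc B n A
  | 0, _, z, a, _ => by simp [ienc, smul]
  | n + 1, [], z, A, hA => absurd hA (WF_succ_nil n A)
  | n + 1, d :: ds, z, A, hA => by
    rw [WF_succ] at hA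
    have h : (ienc B (n + 1) (smul (n + 1) z A) : ℝ) = (z : ℝ) * ienc B (n + 1) A := by
      rw [ienc_succ_cast, ienc_succ_cast]
      show evalL _ _ _ ((toList A).map (smul n z)) = _
      exact evalL_map _ _ (fun c => (ienc B n c : ℝ)) (fun c => (ienc B n c : ℝ)) (smul n z) (z : ℝ) (toList A)
        fun a ha => by exact_mod_cast ienc_smul B n ds z a (hA.2 a ha)
    exact_mod_cast h

/-- `ienc` of a difference. [folklore] -/
theorem ienc_sub (B n : ℕ) (ds : List ℕ) (A A' : Tens n) (hA : WF n ds A) (hA' : WF n ds A') :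
    ienc B n (sub n A A') = ienc B n A - ienc B n A' := by
  rw [sub, ienc_add B n ds A _ hA (smul_spec n ds (-1) A' hA').1, ienc_smul B n ds (-1) A' hA']; ring

/-- `ienc` is multiplicative on well-formed tensors. [folklore] -/
theorem ienc_mul (B : ℕ) : ∀ (n : ℕ) (ds ds' : List ℕ) (A A' : Tens n), ds.length = n → ds'.length = n →
    WF n ds A → WF n ds' A' → ienc B n (mul n A A') = ienc B n A * ienc B n A'
  | 0, _, _, a, a', _, _, _, _ => by simp [ienc, mul]
  | n + 1, [], _, A, _, hds, _, _, _ => by simp at hds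
  | n + 1, _ :: _, [], _, _, _, hds', _, _ => by simp at hds'
  | n + 1, d :: ds, d' :: ds', A, A', hds, hds', hA, hA' => by
    rw [WF_succ] at hA hA'
    simp only [List.length_cons, Nat.add_right_cancel_iff] at hds hds'
    have hAne : toList A ≠ [] := List.ne_nil_of_length_eq_add_one hA.1
    have hA'ne : toList A' ≠ [] := List.ne_nil_of_length_eq_add_one hA'.1
    have key := mulL_spec ((2 : ℝ) ^ gexp B n) 1 (WF n ds) (WF n ds') (WF n (List.zipWith (· + ·) ds ds'))
      (fun c => (ienc B n c : ℝ)) (fun c => (ienc B n c : ℝ)) (fun c => (ienc B n c : ℝ)) (mul n) (add n)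
      (fun a b ha hb => ⟨(mul_spec n ds ds' a b hds hds' ha hb).1, by exact_mod_cast ienc_mul B n ds ds' a b hds hds' ha hb⟩)
      (fun c c' hc hc' => ⟨(add_spec n _ c c' hc hc').1, by exact_mod_cast ienc_add B n _ c c' hc hc'⟩)
      (toList A) (toList A') hAne hA'ne hA.2 hA'.2
    have h : (ienc B (n + 1) (mul (n + 1) A A') : ℝ) = ienc B (n + 1) A * ienc B (n + 1) A' := by
      rw [ienc_succ_cast, ienc_succ_cast, ienc_succ_cast]
      exact key.2.2
    exact_mod_cast h

/-- `ienc` of a lifted tensor. [folklore] -/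
theorem ienc_lift (B n : ℕ) (T : Tens n) : ienc B (n + 1) (lift T) = ienc B n T := by
  simp [ienc, lift, iencL, ishl_eq]

/-! ## Leaf bounds -/

/-- All leaves have absolute value `≤ R`. [folklore] -/
def bndB (R : ℕ) : (n : ℕ) → Tens n → Bool
  | 0, a => decide ((toInt a).natAbs ≤ R)
  | n + 1, L => (toList L).all (bndB R n)

/-- Leaf bound as a proposition. [folklore] -/
abbrev bnd (R n : ℕ) (T : Tens n) : Prop := bndB R n T = true

/-- Leaf bound at depth `0`. [folklore] -/
theorem bnd_zero (R : ℕ) (a : Tens 0) : bnd R 0 a ↔ (toInt a).natAbs ≤ R := by simp [bnd, bndB]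
/-- Leaf bound at depth `n+1`. [folklore] -/
theorem bnd_succ (R n : ℕ) (L : Tens (n + 1)) : bnd R (n + 1) L ↔ ∀ c ∈ toList L, bnd R n c := by
  simp [bnd, bndB, List.all_eq_true]

/-- Leaf bounds are monotone. [folklore] -/
theorem bnd_mono : ∀ (n : ℕ) (R R' : ℕ) (T : Tens n), R ≤ R' → bnd R n T → bnd R' n T
  | 0, _, _, _, h, hT => (bnd_zero _ _).2 (((bnd_zero _ _).1 hT).trans h)
  | n + 1, R, R', _, h, hT => (bnd_succ _ _ _).2 fun c hc => bnd_mono n R R' c h ((bnd_succ _ _ _).1 hT c hc)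

/-- Membership in a long zip. [folklore] -/
theorem mem_zipLong {γ : Type} (f : γ → γ → γ) :
    ∀ (C D : List γ) (e : γ), e ∈ zipLong f C D → e ∈ C ∨ e ∈ D ∨ ∃ c ∈ C, ∃ d ∈ D, e = f c d
  | [], D, e, he => by simp at he; exact Or.inr (Or.inl he)
  | c :: C, [], e, he => by rw [zipLong_cons_nil] at he; exact Or.inl he
  | c :: C, d :: D, e, he => by
    rw [zipLong_cons_cons, List.mem_cons] at he
    rcases he with rfl | he
    · exact Or.inr (Or.inr ⟨c, by simp, d, by simp, rfl⟩)
    · rcases mem_zipLong f C D e he with h | h | ⟨c', hc', d', hd', rfl⟩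
      · exact Or.inl (List.mem_cons_of_mem _ h)
      · exact Or.inr (Or.inl (List.mem_cons_of_mem _ h))
      · exact Or.inr (Or.inr ⟨c', List.mem_cons_of_mem _ hc', d', List.mem_cons_of_mem _ hd', rfl⟩)

/-- Bound of a sum. [folklore] -/
theorem bnd_add : ∀ (n : ℕ) (R R' : ℕ) (A A' : Tens n), bnd R n A → bnd R' n A' → bnd (R + R') n (add n A A')
  | 0, R, R', a, a', hA, hA' => by
    rw [bnd_zero] at hA hA' ⊢
    simp only [add, toInt_ofInt]
    exact (Int.natAbs_add_le _ _).trans (Nat.add_le_add hA hA')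
  | n + 1, R, R', A, A', hA, hA' => by
    rw [bnd_succ] at hA hA' ⊢
    intro e he
    rcases mem_zipLong (add n) _ _ e he with h | h | ⟨c, hc, d, hd, rfl⟩
    · exact bnd_mono n _ _ e (Nat.le_add_right _ _) (hA e h)
    · exact bnd_mono n _ _ e (Nat.le_add_left _ _) (hA' e h)
    · exact bnd_add n R R' c d (hA c hc) (hA' d hd)

/-- Bound of an integer multiple. [folklore] -/
theorem bnd_smul : ∀ (n : ℕ) (R : ℕ) (z : ℤ) (A : Tens n), bnd R n A → bnd (z.natAbs * R) n (smul n z A)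
  | 0, R, z, a, hA => by
    rw [bnd_zero] at hA ⊢
    simp only [smul, toInt_ofInt, Int.natAbs_mul]
    exact Nat.mul_le_mul_left _ hA
  | n + 1, R, z, A, hA => by
    rw [bnd_succ] at hA ⊢
    intro e he
    simp only [smul, toList_ofList, List.mem_map] at he
    obtain ⟨a, ha, rfl⟩ := he
    exact bnd_smul n R z a (hA a ha)

/-- Bound of a difference. [folklore] -/
theorem bnd_sub (n R R' : ℕ) (A A' : Tens n) (hA : bnd R n A) (hA' : bnd R' n A') : bnd (R + R') n (sub n A A') := by
  have h := bnd_add n R (Int.natAbs (-1) * R') A _ hA (bnd_smul n R' (-1) A' hA')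
  simpa [sub] using h

/-- Elements of a convolution are sums of at most `|A|` products (generic bound bookkeeping). [folklore] -/
theorem mulL_bnd {α β γ : Type} (Pα : α → Prop) (Pβ : β → Prop) (Q : ℕ → γ → Prop) (mul : α → β → γ) (add : γ → γ → γ)
    (X : ℕ) (hmul : ∀ a b, Pα a → Pβ b → Q X (mul a b)) (hadd : ∀ s s' c c', Q s c → Q s' c' → Q (s + s') (add c c'))
    (hmono : ∀ s s' e, s ≤ s' → Q s e → Q s' e) :
    ∀ (A : List α) (Bl : List β), (∀ a ∈ A, Pα a) → (∀ b ∈ Bl, Pβ b) → ∀ e ∈ mulL mul add A Bl, Q (A.length * X) e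
  | [], Bl, _, _, e, he => by simp [mulL] at he
  | [a], Bl, hA, hB, e, he => by
    rw [mulL_single, List.mem_map] at he
    obtain ⟨b, hb, rfl⟩ := he
    simpa using hmul a b (hA a (by simp)) (hB b hb)
  | a :: a' :: A, Bl, hA, hB, e, he => by
    have ha : Pα a := hA a (by simp)
    have hA' : ∀ e ∈ a' :: A, Pα e := fun e he => hA e (List.mem_cons_of_mem _ he)
    have IH := mulL_bnd Pα Pβ Q mul add X hmul hadd hmono (a' :: A) Bl hA' hB
    have hlen : (a :: a' :: A).length * X = X + (a' :: A).length * X := by simp [Nat.succ_mul]; ring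
    rw [hlen]
    cases Bl with
    | nil => simp [mulL] at he
    | cons b Bl =>
      rw [mulL_cons_cons, List.mem_cons] at he
      rcases he with rfl | he
      · exact hmono _ _ _ (Nat.le_add_right _ _) (hmul a b ha (hB b (by simp)))
      · rcases mem_zipLong add _ _ e he with h | h | ⟨c, hc, d, hd, rfl⟩
        · rw [List.mem_map] at h; obtain ⟨b', hb', rfl⟩ := h
          exact hmono _ _ _ (Nat.le_add_right _ _) (hmul a b' ha (hB b' (List.mem_cons_of_mem _ hb')))
        · exact hmono _ _ _ (Nat.le_add_left _ _) (IH _ h)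
        · rw [List.mem_map] at hc; obtain ⟨b', hb', rfl⟩ := hc
          exact hadd _ _ _ _ (hmul a b' ha (hB b' (List.mem_cons_of_mem _ hb'))) (IH d hd)

/-- Number of index tuples of a shape: `Π (d_k + 1)`. [folklore] -/
def lenProd (ds : List ℕ) : ℕ := (ds.map (· + 1)).prod

/-- Bound of a product: `R · R' · Π (d_k + 1)` over the shape of the first factor. [folklore] -/
theorem bnd_mul : ∀ (n : ℕ) (ds : List ℕ) (R R' : ℕ) (A A' : Tens n), WF n ds A → bnd R n A → bnd R' n A' →
    bnd (R * R' * lenProd ds) n (mul n A A')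
  | 0, ds, R, R', a, a', hw, hA, hA' => by
    rw [WF_zero] at hw; subst hw
    rw [bnd_zero] at hA hA' ⊢
    simp only [mul, toInt_ofInt, Int.natAbs_mul, lenProd, List.map_nil, List.prod_nil, Nat.mul_one]
    exact Nat.mul_le_mul hA hA'
  | n + 1, [], R, R', A, A', hw, _, _ => absurd hw (WF_succ_nil n A)
  | n + 1, d :: ds, R, R', A, A', hw, hA, hA' => by
    rw [WF_succ] at hw
    rw [bnd_succ] at hA hA' ⊢
    have key := mulL_bnd (fun a => WF n ds a ∧ bnd R n a) (bnd R' n) (fun s c => bnd s n c) (mul n) (add n)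
      (R * R' * lenProd ds) (fun a b ha hb => bnd_mul n ds R R' a b ha.1 ha.2 hb)
      (fun s s' c c' hc hc' => bnd_add n s s' c c' hc hc') (fun s s' e h he => bnd_mono n s s' e h he)
      (toList A) (toList A') (fun a ha => ⟨hw.2 a ha, hA a ha⟩) hA'
    intro e he
    have := key e he
    rw [hw.1] at this
    have hlp : (d + 1) * (R * R' * lenProd ds) = R * R' * lenProd (d :: ds) := by simp [lenProd]; ring
    rw [hlp] at this
    exact this

/-- Bound of a lift. [folklore] -/
theorem bnd_lift (n R : ℕ) (T : Tens n) (h : bnd R n T) : bnd R (n + 1) (lift T) :=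
  (bnd_succ _ _ _).2 fun c hc => by simp only [lift, toList_ofList, List.mem_singleton] at hc; subst hc; exact h


end SBTens

end Summit.CriticalPhenomena.PercolationContinuityZ3.Theorems
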